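import Summits.QuantumFields.YangMills.Theorems.BalabanUVNodesN15BackgroundMatrixByPartsLayerTwoSided
import Summits.QuantumFields.YangMills.Theorems.BalabanUVNodesN15BackgroundMatrixByPartsNode
import HarnessLib

/-!
# `T4EtaRate.NE2PlusOperator` BY NAME FOR THE TWO-SIDED BY-PARTS NON-ABELIAN (MATRIX) FIRST-ORDER FAMILY — all four (3.42) entries constructed, entry 2 by parts, Bałaban's
# `V′₁(A)` species in coordinates WITH BOTH BOND ORIENTATIONS, NO MIXED PIECE (dag-n15-c g9, FILE 20; Track-A node N15 = NE2, s1 «background-layer OPERATOR ingredient»)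

`--kind proof --supports stmt-QuantumFields-20544 --as helper` (K3⁷; count-neutral).  Imports BY NAME this seat's FILE 19 `…N15BackgroundMatrixByPartsLayerTwoSided`
(`coeffBgMBP₂`, `bgInstanceMBP₂`, `bgOpsMBP₂`, `bgFamilyMBP₂`, `bpConst2₂`, `hasMaj_entry2_byParts_matrix₂`, `reg335_coeffBgM₁_of_MBP₂`) and g8 FILE 14 `…N15BackgroundMatrixByPartsNode`
(through it FILE 7b `rowConst_small`, M1-Full `hasMaj_entry3_backgroundM₁`, M1 `hasMaj_entry01_backgroundM₁`, `bgConst` ∕ `bgConst1` ∕ `one_le_pref4`, the readout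
`etaRateIneq342_of_hasMaj`); nothing in the tree is modified.

WHAT.  The two-sided twin of FILE 14: §1 `etaRateIneq342_byParts_matrix₂` (per index, `B₀ = bgConst + bgConst1` at `c₃₅|ι|` and the direction number `|J ⊕ J|` `+ bpConst2₂`,
`δ₀ = δ − 6σ`; entry 1 read on the forward derived piece `inl ν`); §2 ★★★ `ne2PlusOperator_byParts_matrix₂`: `NE2PlusOperator c₃₅ (bgInstanceMBP₂ …) (bgFamilyMBP₂ …)` BY NAME for ANY
index family with UNIFORM `U ≡ 1` letters on the product carriers `X × ι` (pieces; derived pieces over `J ⊕ J` — forward AND backward; Laplacian pieces; the `U ≡ 1` entry-2 operators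
`G∇_ν*` with `∇_ν* = fgradAdj n (liftEquiv e_ν ι)`; their η-defects; the lifted shifts) and the shift-defect row letter on the forward rows (linear in the coefficient scale `c₃₅Mα₀|ι|`) —
the operator layer of (3.42) for the NON-ABELIAN first-order species `M_C + Σ_μ[M_{A_μ}∇_μ + M_{B_μ}∇⁻_μ]` WITHOUT the (3.44) mixed letter.

HONEST FRAMING.  Species = Bałaban's (3.52) `V′₁(A)` IN COORDINATES with FREE matrix coefficient fields on both orientations (entrywise linearised transport); the `U ≡ 1` layer
DISPLAYED; the torus instance at the full propagator (`tensorId ι gOp`, forward derived pieces `(∇_μG) ⊗ 1`, backward ones `(S_{−μ}∇_μG) ⊗ 1`) is the sequel; NE2⁺ NOT PRINTED; N15 not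
discharged; nothing continuum ∕ OS ∕ mass-gap ∕ Clay.
-/

noncomputable section

open scoped BigOperators
open Finset

namespace Summit.QuantumFields.YangMills.BalabanUVNodes.N15.BackgroundLayer

open Literature.MathematicalPhysics.QuantumFieldTheory.Balaban1983to89
open Literature.MathematicalPhysics.QuantumFieldTheory.Balaban1983to89.B11SectG (BlockNorm HasMaj RowSum hasMaj_comp hasMaj_comp_exp hasMaj_zero)
open Literature.MathematicalPhysics.QuantumFieldTheory.Balaban1983to89.T4EtaRate (PairedInstance EtaPairing EtaRateIneq342 NE2PlusOperator rateFactor)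
open Literature.MathematicalPhysics.QuantumFieldTheory.Balaban1983to89.T4EtaRateDefect (idef idef_apply idef_comp rateWeight)
open Literature.MathematicalPhysics.QuantumFieldTheory.Balaban1983to89.T4EtaRateCoeffDefect (pull pull_apply diagK diagK_nonneg)
open Literature.MathematicalPhysics.QuantumFieldTheory.Balaban1983to89.B6RandomWalk (Triangle254)
open Literature.MathematicalPhysics.QuantumFieldTheory.Balaban1983to89.B9SectDSup (inv_one_sub_le_two)
open Summit.QuantumFields.YangMills.BalabanUVNodes.N15.OperatorReadout (opGeo opFamily opGeo_len rateFactor_opGeo etaRateIneq342_of_hasMaj)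
open Summit.QuantumFields.YangMills.BalabanUVNodes.N15.MatrixSpecies (mmulOp liftEquiv liftMap liftBlk)
open Summit.QuantumFields.YangMills.BalabanUVNodes.N15.SiteLayer (hasMaj_exp_comp_diagK hasMaj_diagK_comp_exp hasMaj_add_exp hasMaj_exp_mono)

variable {d : ℕ}

/-! ## §1 Per index `EtaRateIneq342` — all four entries, entry 2 BY PARTS, both orientations -/

section PerIndex

variable {X X' J ι : Type} [Fintype X] [Fintype X'] [Fintype J] [Fintype ι] [DecidableEq X] [DecidableEq X'] [DecidableEq J] [DecidableEq ι] [Nonempty ι]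
  {g : B6.Geometry} (blk : X → g.Site) (π : X' → X)
variable {τ : J → X ≃ X} {τ' : J → X' ≃ X'} {n n' : ℝ} {G D₃ : (X × ι → ℝ) →ₗ[ℝ] (X × ι → ℝ)} {D : J ⊕ J → (X × ι → ℝ) →ₗ[ℝ] (X × ι → ℝ)}
  {G' D₃' : (X' × ι → ℝ) →ₗ[ℝ] (X' × ι → ℝ)} {D' : J ⊕ J → (X' × ι → ℝ) →ₗ[ℝ] (X' × ι → ℝ)}

/-- **`EtaRateIneq342` PER INDEX, TWO-SIDED NON-ABELIAN (MATRIX) FIRST-ORDER SPECIES, ENTRY 2 BY PARTS** (`B₀ = bgConst(…) + bgConst1(…) + bpConst2₂(…)`, `δ₀ = δ − 6σ`): the data of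
`hasMaj_entry2_byParts_matrix₂` plus the `U ≡ 1` Laplacian pieces `D₃′ ≤ βe^{−δd}`, `𝔇(D₃′,D₃) ≤ m₀θe^{−δd}` (entry 3, M1-Full `hasMaj_entry3_backgroundM₁`), `η, L > 0`, sites of size `≥ 1`,
`θ ≤ (L^j)^{−γ}`. [cite: Balaban1985BackgroundPropagators, Thm 3.1 (3.42) p.397 (shape, quantifier template)] -/
theorem etaRateIneq342_byParts_matrix₂ (htri : Triangle254 g) (hd : ∀ a b : g.Site, 0 ≤ g.dist a b) (hd0 : ∀ y : g.Site, g.dist y y = 0) {σ cr : ℝ} (hσ : 0 ≤ σ)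
    (hcr : 0 ≤ cr) (hrow : RowSum g σ cr) (hη : 0 < g.eta) (hL : 0 < g.L) (hlen : ∀ y, 1 ≤ g.len y) {δ β m₀ θ c35 a₀ M α₀ γ cT mT : ℝ} (hσδ : 6 * σ ≤ δ)
    (hβ : 0 ≤ β) (hm₀ : 0 ≤ m₀) (hθ : 0 ≤ θ) (hθγ : ∀ y, θ ≤ rateWeight g γ y) (hc35 : 0 < c35) (ha₀ : 0 ≤ a₀)
    (hq : β * (c35 * (Fintype.card ι * (1 + Fintype.card (J ⊕ J))) * a₀) * cr ≤ 1 / 2) (hM : 1 ≤ M) (hα₀ : 0 < α₀) (hMα : M * α₀ ≤ a₀) (hcT : 0 ≤ cT) (hmT : 0 ≤ mT)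
    (hq2 : 1 * rowConst (Fintype.card J) β cT (c35 * Fintype.card ι * a₀) cr * cr * cr ≤ 1 / 2) {ν : J}
    (hG : HasMaj (BlockNorm.ofBlocks g (liftBlk blk ι)) (BlockNorm.ofBlocks g (liftBlk blk ι)) G (fun y y' => β * Real.exp (-(δ * g.dist y y'))))
    (hD : ∀ μ, HasMaj (BlockNorm.ofBlocks g (liftBlk blk ι)) (BlockNorm.ofBlocks g (liftBlk blk ι)) (D μ) (fun y y' => β * Real.exp (-(δ * g.dist y y'))))
    (hG' : HasMaj (BlockNorm.ofBlocks g (liftBlk (blk ∘ π) ι)) (BlockNorm.ofBlocks g (liftBlk (blk ∘ π) ι)) G' (fun y y' => β * Real.exp (-(δ * g.dist y y'))))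
    (hD' : ∀ μ, HasMaj (BlockNorm.ofBlocks g (liftBlk (blk ∘ π) ι)) (BlockNorm.ofBlocks g (liftBlk (blk ∘ π) ι)) (D' μ) (fun y y' => β * Real.exp (-(δ * g.dist y y'))))
    (hD₃' : HasMaj (BlockNorm.ofBlocks g (liftBlk (blk ∘ π) ι)) (BlockNorm.ofBlocks g (liftBlk (blk ∘ π) ι)) D₃' (fun y y' => β * Real.exp (-(δ * g.dist y y'))))
    (hDG : HasMaj (BlockNorm.ofBlocks g (liftBlk blk ι)) (BlockNorm.ofBlocks g (liftBlk (blk ∘ π) ι)) (idef (pull (liftMap π ι)) (pull (liftMap π ι)) G' G)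
      (fun y y' => m₀ * θ * Real.exp (-(δ * g.dist y y'))))
    (hDD : ∀ μ, HasMaj (BlockNorm.ofBlocks g (liftBlk blk ι)) (BlockNorm.ofBlocks g (liftBlk (blk ∘ π) ι)) (idef (pull (liftMap π ι)) (pull (liftMap π ι)) (D' μ) (D μ))
      (fun y y' => m₀ * θ * Real.exp (-(δ * g.dist y y'))))
    (hDD₃ : HasMaj (BlockNorm.ofBlocks g (liftBlk blk ι)) (BlockNorm.ofBlocks g (liftBlk (blk ∘ π) ι)) (idef (pull (liftMap π ι)) (pull (liftMap π ι)) D₃' D₃)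
      (fun y y' => m₀ * θ * Real.exp (-(δ * g.dist y y'))))
    (hS : ∀ ν, HasMaj (BlockNorm.ofBlocks g (liftBlk blk ι)) (BlockNorm.ofBlocks g (liftBlk blk ι)) (G ∘ₗ fgradAdj n (liftEquiv (τ ν) ι)) (fun y y' => β * Real.exp (-(δ * g.dist y y'))))
    (hS' : ∀ ν, HasMaj (BlockNorm.ofBlocks g (liftBlk (blk ∘ π) ι)) (BlockNorm.ofBlocks g (liftBlk (blk ∘ π) ι)) (G' ∘ₗ fgradAdj n' (liftEquiv (τ' ν) ι)) (fun y y' => β * Real.exp (-(δ * g.dist y y'))))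
    (hDS : ∀ ν, HasMaj (BlockNorm.ofBlocks g (liftBlk blk ι)) (BlockNorm.ofBlocks g (liftBlk (blk ∘ π) ι)) (idef (pull (liftMap π ι)) (pull (liftMap π ι)) (G' ∘ₗ fgradAdj n' (liftEquiv (τ' ν) ι)) (G ∘ₗ fgradAdj n (liftEquiv (τ ν) ι)))
      (fun y y' => m₀ * θ * Real.exp (-(δ * g.dist y y'))))
    (hSh : ∀ μ, HasMaj (BlockNorm.ofBlocks g (liftBlk blk ι)) (BlockNorm.ofBlocks g (liftBlk blk ι)) (pull (liftEquiv (τ μ) ι)) (fun y y' => cT * Real.exp (-(δ * g.dist y y'))))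
    (hSh' : ∀ μ, HasMaj (BlockNorm.ofBlocks g (liftBlk (blk ∘ π) ι)) (BlockNorm.ofBlocks g (liftBlk (blk ∘ π) ι)) (pull (liftEquiv (τ' μ) ι)) (fun y y' => cT * Real.exp (-(δ * g.dist y y'))))
    {U : (X' → Matrix ι ι ℝ) × (J ⊕ J → X' → Matrix ι ι ℝ)} (hreg : (coeffBgMBP₂ J ι π τ τ' n n' M θ).Reg335 c35 α₀ U)
    (hDSh : ∀ μ, HasMaj (BlockNorm.ofBlocks g (liftBlk (liftBlk blk ι) J)) (BlockNorm.ofBlocks g (liftBlk (blk ∘ π) ι))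
      (idef (pull (liftMap π ι)) (pull (liftMap π ι)) (pull (liftEquiv (τ' μ) ι)) (pull (liftEquiv (τ μ) ι)) ∘ₗ
        (mmulOp ((avgM₁ (J ⊕ J) ι π U).2 (Sum.inl μ) ∘ ⇑(τ μ).symm) ∘ₗ sumJ fun ν => G ∘ₗ fgradAdj n (liftEquiv (τ ν) ι))) (fun y y' => mT * θ * Real.exp (-(δ * g.dist y y')))) :
    EtaRateIneq342 (opFamily (g := g) (B := coeffBgMBP₂ J ι π τ τ' n n' g.M θ) (liftBlk blk ι) (liftBlk (blk ∘ π) ι) (bgOpsMBP₂ π τ τ' n n' ν G D₃ D G' D₃' D'))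
      (bgConst β cr m₀ (c35 * (Fintype.card ι * (1 + Fintype.card (J ⊕ J)))) a₀ + bgConst1 β cr m₀ (c35 * (Fintype.card ι * (1 + Fintype.card (J ⊕ J)))) a₀ +
        bpConst2₂ (Fintype.card J) (Fintype.card (J ⊕ J)) β cr m₀ (c35 * Fintype.card ι) a₀ cT mT) (δ - 6 * σ) γ U := by
  have hnJ : (0 : ℝ) ≤ Fintype.card J := Nat.cast_nonneg _
  have hnJ2 : (0 : ℝ) ≤ Fintype.card (J ⊕ J) := Nat.cast_nonneg _
  have hJ0 : (0 : ℝ) ≤ 1 + Fintype.card (J ⊕ J) := by positivity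
  have hc35J : 0 ≤ c35 * (Fintype.card ι * (1 + Fintype.card (J ⊕ J))) := by positivity
  have hσδ' : σ ≤ δ := by linarith
  have hreg₁ : (coeffBgM₁ (J ⊕ J) ι π M θ).Reg335 c35 α₀ U := reg335_coeffBgM₁_of_MBP₂ J ι hreg
  have h01 := hasMaj_entry01_backgroundM₁ blk π htri hd hσ hcr hrow hσδ' hβ hm₀ hθ hc35 hq hM hα₀ hMα hG hD hG' hD' hDG hDD hreg₁
  have h2 := hasMaj_entry2_byParts_matrix₂ blk π htri hd hd0 hσ hcr hrow hσδ hβ hm₀ hθ hc35 ha₀ hq hM hα₀ hMα hcT hmT hq2 hG hD hG' hD' hDG hDD hS hS' hDS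
    hSh hSh' hreg hDSh ν
  have h3 := hasMaj_entry3_backgroundM₁ blk π htri hd hσ hcr hrow hσδ' hβ hm₀ hθ hc35 ha₀ hq hM hα₀ hMα hG hD hG' hD' hD₃' hDG hDD hDD₃ hreg₁
  have hC0 : 0 ≤ bgConst β cr m₀ (c35 * (Fintype.card ι * (1 + Fintype.card (J ⊕ J)))) a₀ := bgConst_nonneg hβ hcr hm₀ hc35J ha₀
  have hC1 : 0 ≤ bgConst1 β cr m₀ (c35 * (Fintype.card ι * (1 + Fintype.card (J ⊕ J)))) a₀ := bgConst1_nonneg hβ hcr hm₀ hc35J ha₀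
  have hC2 : 0 ≤ bpConst2₂ (Fintype.card J) (Fintype.card (J ⊕ J)) β cr m₀ (c35 * Fintype.card ι) a₀ cT mT :=
    bpConst2₂_nonneg hnJ hnJ2 hβ hcr hm₀ (by positivity) ha₀ hcT hmT (by linarith)
  set B₀ := bgConst β cr m₀ (c35 * (Fintype.card ι * (1 + Fintype.card (J ⊕ J)))) a₀ + bgConst1 β cr m₀ (c35 * (Fintype.card ι * (1 + Fintype.card (J ⊕ J)))) a₀ + bpConst2₂ (Fintype.card J) (Fintype.card (J ⊕ J)) β cr m₀ (c35 * Fintype.card ι) a₀ cT mT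
    with hB₀def
  have hB₀ : 0 ≤ B₀ := add_nonneg (add_nonneg hC0 hC1) hC2
  refine etaRateIneq342_of_hasMaj (g := g) (B := coeffBgMBP₂ J ι π τ τ' n n' g.M θ) (liftBlk blk ι) (liftBlk (blk ∘ π) ι) hη.le hL.le hB₀ (bgOpsMBP₂ π τ τ' n n' ν G D₃ D G' D₃' D') U fun k => ?_
  have hdom : ∀ {B ρ : ℝ}, 0 ≤ B → B ≤ B₀ → δ - 6 * σ ≤ ρ → ∀ y y' : g.Site,
      B * θ * Real.exp (-(ρ * g.dist y y')) ≤
        B₀ * B9.pref4 ((opGeo g (X × ι) (liftBlk blk ι)).len y) k * Real.exp (-((δ - 6 * σ) * g.dist y y')) * max (rateFactor (opGeo g (X × ι) (liftBlk blk ι)) γ y) (rateFactor (opGeo g (X × ι) (liftBlk blk ι)) γ y') := by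
    intro B ρ hB0 hB hρ y y'
    have hpref : 1 ≤ B9.pref4 ((opGeo g (X × ι) (liftBlk blk ι)).len y) k := by rw [opGeo_len]; exact one_le_pref4 (hlen y) k
    have hexp : Real.exp (-(ρ * g.dist y y')) ≤ Real.exp (-((δ - 6 * σ) * g.dist y y')) :=
      Real.exp_le_exp.mpr (neg_le_neg (mul_le_mul_of_nonneg_right hρ (hd y y')))
    have hrf : θ ≤ max (rateFactor (opGeo g (X × ι) (liftBlk blk ι)) γ y) (rateFactor (opGeo g (X × ι) (liftBlk blk ι)) γ y') := by
      rw [rateFactor_opGeo g (X × ι) (liftBlk blk ι) hη.ne' hL γ y']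
      exact (hθγ y').trans (le_max_right _ _)
    have hE : 0 ≤ Real.exp (-((δ - 6 * σ) * g.dist y y')) := Real.exp_nonneg _
    calc B * θ * Real.exp (-(ρ * g.dist y y'))
        ≤ (B₀ * B9.pref4 ((opGeo g (X × ι) (liftBlk blk ι)).len y) k) * θ * Real.exp (-((δ - 6 * σ) * g.dist y y')) := by
          refine mul_le_mul (mul_le_mul_of_nonneg_right ?_ hθ) hexp (Real.exp_nonneg _) (mul_nonneg (mul_nonneg hB₀ (zero_le_one.trans hpref)) hθ)
          calc B = B * 1 := (mul_one B).symm
            _ ≤ _ := mul_le_mul hB hpref zero_le_one hB₀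
      _ = B₀ * B9.pref4 ((opGeo g (X × ι) (liftBlk blk ι)).len y) k * Real.exp (-((δ - 6 * σ) * g.dist y y')) * θ := by ring
      _ ≤ _ := mul_le_mul_of_nonneg_left hrf (mul_nonneg (mul_nonneg hB₀ (zero_le_one.trans hpref)) hE)
  fin_cases k
  · exact (h01 none).mono (hdom hC0 (by rw [hB₀def]; linarith) (by linarith))
  · exact (h01 (some (Sum.inl ν))).mono (hdom hC0 (by rw [hB₀def]; linarith) (by linarith))
  · exact h2.mono (hdom hC2 (by rw [hB₀def]; linarith) le_rfl)
  · exact h3.mono (hdom hC1 (by rw [hB₀def]; linarith) (by linarith))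

end PerIndex

/-! ## §2 The node's first conjunct BY NAME: `NE2PlusOperator`, entry 2 by parts, both orientations -/

section Node

variable {I J ι : Type} [Fintype J] [DecidableEq J] [Fintype ι] [DecidableEq ι] [Nonempty ι] (g : I → B6.Geometry) (X X' : I → Type) [∀ i, Fintype (X i)]
  [∀ i, Fintype (X' i)] [∀ i, DecidableEq (X i)] [∀ i, DecidableEq (X' i)] (blk : ∀ i, X i → (g i).Site) (π : ∀ i, X' i → X i) (τ : ∀ i, J → X i ≃ X i)
  (τ' : ∀ i, J → X' i ≃ X' i) (n n' : I → ℝ) (nsh : I → ℕ) (hL0 : ∀ i, (g i).L ≠ 0) (θc θ : I → ℝ) (ν : I → J) (G D₃ : ∀ i, (X i × ι → ℝ) →ₗ[ℝ] (X i × ι → ℝ))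
  (D : ∀ i, J ⊕ J → (X i × ι → ℝ) →ₗ[ℝ] (X i × ι → ℝ)) (G' D₃' : ∀ i, (X' i × ι → ℝ) →ₗ[ℝ] (X' i × ι → ℝ)) (D' : ∀ i, J ⊕ J → (X' i × ι → ℝ) →ₗ[ℝ] (X' i × ι → ℝ))

/-- ★★★ **NE2⁺, OPERATOR LAYER — `T4EtaRate.NE2PlusOperator` BY NAME, TWO-SIDED NON-ABELIAN (MATRIX) FIRST-ORDER SPECIES ON THE PRODUCT CARRIERS `X × ι` (BOTH BOND ORIENTATIONS), ALL FOUR ENTRIES CONSTRUCTED, ENTRY 2 BY PARTS — NO MIXED PIECE.**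
For ANY family with UNIFORM `U ≡ 1` letters at rate `δ` (`6σ < δ`): pieces `G_i, G′_i`, derived pieces `D_{i,μ}, D′_{i,μ}`, Laplacian pieces `D₃′_i`, the `U ≡ 1` ENTRY-2 operators
`G_i∇_ν*, G′_i∇′_ν*` (`∇_ν* = fgradAdj n_i (τ_i ν)`) — all `≤ βe^{−δd}` —, the η-defects of the four kinds `≤ m₀θ_ie^{−δd}`, the one-step shifts `≤ c_Te^{−δd}`, and THE
SHIFT-DEFECT ROW LETTER for every regular configuration (`≤ m_T·(c₃₅Mα₀)·θ_ie^{−δd}`, linear in the coefficient scale — FILE 4's shape); `0 ≤ θ_i ≤ (L^j)^{−γ}`, `γ > 0`; [B6] carriers ((2.54), `d ≥ 0`, `d(y,y) = 0`, uniform (2.61)),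
`η, L > 0`, sites of size `≥ 1`; `c₃₅ > 0` —: `NE2PlusOperator c₃₅ (bgInstanceMBP …) (bgFamilyMBP …)` with `M₅ = 1`, `a₀ = min((2c₃₅(1+|J|)(βc_r+1))⁻¹, (2(K+1))⁻¹)`
(`K = (c_T+1)c₃₅|J|βc_r³`), `B₀ = bgConst + bgConst1 + bpConst2(…, m_Tc₃₅a₀) + 1`, `δ₀ = δ − 6σ`; the carrier's (3.35)–(3.36) letters CONSUMED on every coefficient.  For the lineage's
non-abelian first-order species (g2 M1, coefficients = matrix fields in coordinates `𝔤 ≅ ℝ^ι`, row letters `c₃₅Mα₀|ι|`) this is the operator layer WITHOUT the (3.44) mixed letter.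
[cite: Balaban1985BackgroundPropagators, Thm 3.1 p.397 (quantifier template); (3.35)–(3.36) p.396, (3.42) p.397, (3.52) p.400, (3.63)–(3.65) p.402 (shapes, mechanism)] -/
theorem ne2PlusOperator_byParts_matrix₂ (c35 : ℝ) (hc35 : 0 < c35)
    (htri : ∀ i, Triangle254 (g i)) (hd : ∀ i (a b : (g i).Site), 0 ≤ (g i).dist a b) (hd0 : ∀ i (y : (g i).Site), (g i).dist y y = 0) {σ cr : ℝ} (hσ : 0 ≤ σ)
    (hcr : 0 ≤ cr) (hrow : ∀ i, RowSum (g i) σ cr) (hη : ∀ i, 0 < (g i).eta) (hL : ∀ i, 0 < (g i).L) (hlen : ∀ i y, 1 ≤ (g i).len y)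
    {δ β m₀ γ cT mT : ℝ} (hσδ : 6 * σ < δ) (hβ : 0 ≤ β) (hm₀ : 0 ≤ m₀) (hγ : 0 < γ) (hθ : ∀ i, 0 ≤ θ i) (hθγ : ∀ i y, θ i ≤ rateWeight (g i) γ y)
    (hcT : 0 ≤ cT) (hmT : 0 ≤ mT)
    (hG : ∀ i, HasMaj (BlockNorm.ofBlocks (g i) (liftBlk (blk i) ι)) (BlockNorm.ofBlocks (g i) (liftBlk (blk i) ι)) (G i) (fun y y' => β * Real.exp (-(δ * (g i).dist y y'))))
    (hD : ∀ i μ, HasMaj (BlockNorm.ofBlocks (g i) (liftBlk (blk i) ι)) (BlockNorm.ofBlocks (g i) (liftBlk (blk i) ι)) (D i μ)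
      (fun y y' => β * Real.exp (-(δ * (g i).dist y y'))))
    (hG' : ∀ i, HasMaj (BlockNorm.ofBlocks (g i) (liftBlk (blk i ∘ π i) ι)) (BlockNorm.ofBlocks (g i) (liftBlk (blk i ∘ π i) ι)) (G' i)
      (fun y y' => β * Real.exp (-(δ * (g i).dist y y'))))
    (hD' : ∀ i μ, HasMaj (BlockNorm.ofBlocks (g i) (liftBlk (blk i ∘ π i) ι)) (BlockNorm.ofBlocks (g i) (liftBlk (blk i ∘ π i) ι)) (D' i μ)
      (fun y y' => β * Real.exp (-(δ * (g i).dist y y'))))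
    (hD₃' : ∀ i, HasMaj (BlockNorm.ofBlocks (g i) (liftBlk (blk i ∘ π i) ι)) (BlockNorm.ofBlocks (g i) (liftBlk (blk i ∘ π i) ι)) (D₃' i)
      (fun y y' => β * Real.exp (-(δ * (g i).dist y y'))))
    (hDG : ∀ i, HasMaj (BlockNorm.ofBlocks (g i) (liftBlk (blk i) ι)) (BlockNorm.ofBlocks (g i) (liftBlk (blk i ∘ π i) ι)) (idef (pull (liftMap (π i) ι)) (pull (liftMap (π i) ι)) (G' i) (G i))
      (fun y y' => m₀ * θ i * Real.exp (-(δ * (g i).dist y y'))))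
    (hDD : ∀ i μ, HasMaj (BlockNorm.ofBlocks (g i) (liftBlk (blk i) ι)) (BlockNorm.ofBlocks (g i) (liftBlk (blk i ∘ π i) ι))
      (idef (pull (liftMap (π i) ι)) (pull (liftMap (π i) ι)) (D' i μ) (D i μ)) (fun y y' => m₀ * θ i * Real.exp (-(δ * (g i).dist y y'))))
    (hDD₃ : ∀ i, HasMaj (BlockNorm.ofBlocks (g i) (liftBlk (blk i) ι)) (BlockNorm.ofBlocks (g i) (liftBlk (blk i ∘ π i) ι)) (idef (pull (liftMap (π i) ι)) (pull (liftMap (π i) ι)) (D₃' i) (D₃ i))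
      (fun y y' => m₀ * θ i * Real.exp (-(δ * (g i).dist y y'))))
    (hS : ∀ i ν, HasMaj (BlockNorm.ofBlocks (g i) (liftBlk (blk i) ι)) (BlockNorm.ofBlocks (g i) (liftBlk (blk i) ι)) (G i ∘ₗ fgradAdj (n i) (liftEquiv (τ i ν) ι))
      (fun y y' => β * Real.exp (-(δ * (g i).dist y y'))))
    (hS' : ∀ i ν, HasMaj (BlockNorm.ofBlocks (g i) (liftBlk (blk i ∘ π i) ι)) (BlockNorm.ofBlocks (g i) (liftBlk (blk i ∘ π i) ι)) (G' i ∘ₗ fgradAdj (n' i) (liftEquiv (τ' i ν) ι))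
      (fun y y' => β * Real.exp (-(δ * (g i).dist y y'))))
    (hDS : ∀ i ν, HasMaj (BlockNorm.ofBlocks (g i) (liftBlk (blk i) ι)) (BlockNorm.ofBlocks (g i) (liftBlk (blk i ∘ π i) ι))
      (idef (pull (liftMap (π i) ι)) (pull (liftMap (π i) ι)) (G' i ∘ₗ fgradAdj (n' i) (liftEquiv (τ' i ν) ι)) (G i ∘ₗ fgradAdj (n i) (liftEquiv (τ i ν) ι))) (fun y y' => m₀ * θ i * Real.exp (-(δ * (g i).dist y y'))))
    (hSh : ∀ i μ, HasMaj (BlockNorm.ofBlocks (g i) (liftBlk (blk i) ι)) (BlockNorm.ofBlocks (g i) (liftBlk (blk i) ι)) (pull (liftEquiv (τ i μ) ι)) (fun y y' => cT * Real.exp (-(δ * (g i).dist y y'))))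
    (hSh' : ∀ i μ, HasMaj (BlockNorm.ofBlocks (g i) (liftBlk (blk i ∘ π i) ι)) (BlockNorm.ofBlocks (g i) (liftBlk (blk i ∘ π i) ι)) (pull (liftEquiv (τ' i μ) ι))
      (fun y y' => cT * Real.exp (-(δ * (g i).dist y y'))))
    (hDSh : ∀ i (U : (X' i → Matrix ι ι ℝ) × (J ⊕ J → X' i → Matrix ι ι ℝ)) (α₀ : ℝ), (coeffBgMBP₂ J ι (π i) (τ i) (τ' i) (n i) (n' i) (g i).M (θ i)).Reg335 c35 α₀ U →
      ∀ μ, HasMaj (BlockNorm.ofBlocks (g i) (liftBlk (liftBlk (blk i) ι) J)) (BlockNorm.ofBlocks (g i) (liftBlk (blk i ∘ π i) ι))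
        (idef (pull (liftMap (π i) ι)) (pull (liftMap (π i) ι)) (pull (liftEquiv (τ' i μ) ι)) (pull (liftEquiv (τ i μ) ι)) ∘ₗ
          (mmulOp ((avgM₁ (J ⊕ J) ι (π i) U).2 (Sum.inl μ) ∘ ⇑(τ i μ).symm) ∘ₗ sumJ fun ν => G i ∘ₗ fgradAdj (n i) (liftEquiv (τ i ν) ι)))
        (fun y y' => mT * (c35 * (g i).M * α₀ * Fintype.card ι) * θ i * Real.exp (-(δ * (g i).dist y y')))) :
    NE2PlusOperator c35 (fun i => bgInstanceMBP₂ J ι (blk i) (π i) (τ i) (τ' i) (n i) (n' i) (nsh i) (hL0 i) (θc i) (θ i))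
      (fun i => bgFamilyMBP₂ (blk i) (π i) (τ i) (τ' i) (n i) (n' i) (nsh i) (hL0 i) (θc i) (θ i) (ν i) (G i) (D₃ i) (D i) (G' i) (D₃' i) (D' i)) := by
  have hnJ : (0 : ℝ) ≤ Fintype.card J := Nat.cast_nonneg _
  have hnJ2 : (0 : ℝ) ≤ Fintype.card (J ⊕ J) := Nat.cast_nonneg _
  have hJ1 : (1 : ℝ) ≤ 1 + Fintype.card (J ⊕ J) := le_add_of_nonneg_right hnJ2
  have hJ0 : (0 : ℝ) < 1 + Fintype.card (J ⊕ J) := lt_of_lt_of_le one_pos hJ1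
  -- the guard constant of B4 and the by-parts one
  set a₁ : ℝ := (2 * (c35 * (Fintype.card ι * (1 + Fintype.card (J ⊕ J)))) * (β * cr + 1))⁻¹ with ha₁_def
  set a₂ : ℝ := (2 * ((cT + 1) * (c35 * Fintype.card ι) * Fintype.card J * β * (cr * cr * cr) + 1))⁻¹ with ha₂_def
  have hden₁ : 0 < 2 * (c35 * (Fintype.card ι * (1 + Fintype.card (J ⊕ J)))) * (β * cr + 1) := by positivity
  have hden₂ : 0 < 2 * ((cT + 1) * (c35 * Fintype.card ι) * Fintype.card J * β * (cr * cr * cr) + 1) := by positivity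
  have ha₁ : 0 < a₁ := inv_pos.2 hden₁
  have ha₂ : 0 < a₂ := inv_pos.2 hden₂
  set a₀ : ℝ := min a₁ a₂ with ha₀_def
  have ha₀ : 0 < a₀ := lt_min ha₁ ha₂
  have hq : β * (c35 * (Fintype.card ι * (1 + Fintype.card (J ⊕ J))) * a₀) * cr ≤ 1 / 2 := by
    have hq₁ : β * (c35 * (Fintype.card ι * (1 + Fintype.card (J ⊕ J))) * a₁) * cr ≤ 1 / 2 := by
      have h1 : β * (c35 * (Fintype.card ι * (1 + Fintype.card (J ⊕ J))) * a₁) * cr = (β * cr) * (c35 * (Fintype.card ι * (1 + Fintype.card (J ⊕ J))) * a₁) := by ring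
      have h2 : c35 * (Fintype.card ι * (1 + Fintype.card (J ⊕ J))) * a₁ = (2 * (β * cr + 1))⁻¹ := by
        rw [ha₁_def]; field_simp
      rw [h1, h2, ← div_eq_mul_inv, div_le_iff₀ (by positivity)]
      nlinarith [mul_nonneg hβ hcr]
    refine le_trans ?_ hq₁
    have : a₀ ≤ a₁ := min_le_left _ _
    have h0 : 0 ≤ β * (c35 * (Fintype.card ι * (1 + Fintype.card (J ⊕ J)))) * cr := by positivity
    nlinarith
  have hq2 : 1 * rowConst (Fintype.card J) β cT (c35 * Fintype.card ι * a₀) cr * cr * cr ≤ 1 / 2 :=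
    rowConst_small hnJ hβ hcT (by positivity) hcr (min_le_right _ _)
  have hC0 : 0 ≤ bgConst β cr m₀ (c35 * (Fintype.card ι * (1 + Fintype.card (J ⊕ J)))) a₀ := bgConst_nonneg hβ hcr hm₀ (by positivity) ha₀.le
  have hC1 : 0 ≤ bgConst1 β cr m₀ (c35 * (Fintype.card ι * (1 + Fintype.card (J ⊕ J)))) a₀ := bgConst1_nonneg hβ hcr hm₀ (by positivity) ha₀.le
  have hmT' : 0 ≤ mT * (c35 * Fintype.card ι * a₀) := mul_nonneg hmT (by positivity)
  have hC2 : 0 ≤ bpConst2₂ (Fintype.card J) (Fintype.card (J ⊕ J)) β cr m₀ (c35 * Fintype.card ι) a₀ cT (mT * (c35 * Fintype.card ι * a₀)) :=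
    bpConst2₂_nonneg hnJ hnJ2 hβ hcr hm₀ (by positivity) ha₀.le hcT hmT' (by linarith)
  refine ⟨1, δ - 6 * σ, a₀, bgConst β cr m₀ (c35 * (Fintype.card ι * (1 + Fintype.card (J ⊕ J)))) a₀ + bgConst1 β cr m₀ (c35 * (Fintype.card ι * (1 + Fintype.card (J ⊕ J)))) a₀ +
    bpConst2₂ (Fintype.card J) (Fintype.card (J ⊕ J)) β cr m₀ (c35 * Fintype.card ι) a₀ cT (mT * (c35 * Fintype.card ι * a₀)) + 1, γ, one_pos, by linarith, ha₀, by linarith, hγ, fun i hM α₀ hα₀ hMα U hreg => ?_⟩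
  have hM' : 1 ≤ (g i).M := hM
  have hMα' : (g i).M * α₀ ≤ a₀ := hMα
  -- the shift-defect row letter under the guard: `m_T·c₃₅Mα₀ ≤ m_T·c₃₅a₀`
  have hDSh' : ∀ μ, HasMaj (BlockNorm.ofBlocks (g i) (liftBlk (liftBlk (blk i) ι) J)) (BlockNorm.ofBlocks (g i) (liftBlk (blk i ∘ π i) ι))
      (idef (pull (liftMap (π i) ι)) (pull (liftMap (π i) ι)) (pull (liftEquiv (τ' i μ) ι)) (pull (liftEquiv (τ i μ) ι)) ∘ₗ
        (mmulOp ((avgM₁ (J ⊕ J) ι (π i) U).2 (Sum.inl μ) ∘ ⇑(τ i μ).symm) ∘ₗ sumJ fun ν => G i ∘ₗ fgradAdj (n i) (liftEquiv (τ i ν) ι)))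
      (fun y y' => mT * (c35 * Fintype.card ι * a₀) * θ i * Real.exp (-(δ * (g i).dist y y'))) := fun μ =>
    (hDSh i U α₀ hreg μ).mono fun y y' => by
      have h1 : c35 * (g i).M * α₀ * Fintype.card ι ≤ c35 * Fintype.card ι * a₀ := by
        calc c35 * (g i).M * α₀ * Fintype.card ι = c35 * Fintype.card ι * ((g i).M * α₀) := by ring
          _ ≤ c35 * Fintype.card ι * a₀ := mul_le_mul_of_nonneg_left hMα' (by positivity)
      have h2 : 0 ≤ θ i * Real.exp (-(δ * (g i).dist y y')) := mul_nonneg (hθ i) (Real.exp_nonneg _)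
      nlinarith [mul_le_mul_of_nonneg_left h1 hmT]
  have key := etaRateIneq342_byParts_matrix₂ (J := J) (ι := ι) (blk i) (π i) (htri i) (hd i) (hd0 i) hσ hcr (hrow i) (hη i) (hL i) (hlen i) hσδ.le hβ hm₀ (hθ i) (hθγ i) hc35
    ha₀.le hq hM' hα₀ hMα' hcT hmT' hq2 (ν := ν i) (hG i) (hD i) (hG' i) (hD' i) (hD₃' i) (hDG i) (hDD i) (hDD₃ i) (hS i) (hS' i) (hDS i) (hSh i) (hSh' i) hreg
    hDSh'
  intro k lam y y' hs
  refine (key k lam y y' hs).trans ?_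
  have hpref : 0 ≤ B9.pref4 ((bgInstanceMBP₂ J ι (blk i) (π i) (τ i) (τ' i) (n i) (n' i) (nsh i) (hL0 i) (θc i) (θ i)).gc.len y) k := by
    have : 1 ≤ B9.pref4 ((opGeo (g i) (X i × ι) (liftBlk (blk i) ι)).len y) k := by rw [opGeo_len]; exact one_le_pref4 (hlen i y) k
    exact zero_le_one.trans this
  have hrf : 0 ≤ max (rateFactor (bgInstanceMBP₂ J ι (blk i) (π i) (τ i) (τ' i) (n i) (n' i) (nsh i) (hL0 i) (θc i) (θ i)).gc γ y)
      (rateFactor (bgInstanceMBP₂ J ι (blk i) (π i) (τ i) (τ' i) (n i) (n' i) (nsh i) (hL0 i) (θc i) (θ i)).gc γ y') :=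
    (T4EtaRate.rateFactor_nonneg (g := opGeo (g i) (X i) (blk i)) (hη i).le (hL i).le γ y).trans (le_max_left _ _)
  have hnorm : 0 ≤ (bgInstanceMBP₂ J ι (blk i) (π i) (τ i) (τ' i) (n i) (n' i) (nsh i) (hL0 i) (θc i) (θ i)).gc.supNorm lam := Real.iSup_nonneg fun x => abs_nonneg _
  have hE : 0 ≤ Real.exp (-((δ - 6 * σ) * (bgInstanceMBP₂ J ι (blk i) (π i) (τ i) (τ' i) (n i) (n' i) (nsh i) (hL0 i) (θc i) (θ i)).gc.dist y y')) := Real.exp_nonneg _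
  exact mul_le_mul_of_nonneg_right (mul_le_mul_of_nonneg_right (mul_le_mul_of_nonneg_right
    (mul_le_mul_of_nonneg_right (le_add_of_nonneg_right zero_le_one) hpref) hE) hrf) hnorm

end Node

end Summit.QuantumFields.YangMills.BalabanUVNodes.N15.BackgroundLayer

end
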